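import Literature.MathematicalPhysics.QuantumManyBody.PeriodicSlotDepletion
import Literature.Analysis.InnerProduct.CompactEmbeddingGraphNorm
import HarnessLib
-- module: Summits.AtomisticToContinuum.BoseEinsteinCondensation.Theorems.BECRewardDescentRewardChordBoundRewardedFormSpectrum

/-!
# The two lowest eigenvalues of the REWARDED periodic `N`-boson form
# (crux `RewardChordBound`, stmt-AtomisticToContinuum-12876, stub 4a `stub_rewardedKyFanGapIntegrable`, helper file F4)

Rewarded twin of `Literature/…/PeriodicFormSpectrum.lean` (plan F4 of the rewarded max-form package, definitions
in `Literature/…/PeriodicSlotDepletion.lean`); def-free helper file of stub 4a. For `L > 0`,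
`N ≥ 1`, a measurable profile `v` with `W = ∑_{i<j} v^per(xᵢ - xⱼ) ∈ L¹` of the cell and a reward `s ≥ 0`,
the rewarded form `q_s(Ψ) = ∫ |∇Ψ|² + W|Ψ|² + s·dep(Ψ)` (`dep = N - n̂₀`, the zero-mode depletion, a
bounded non-negative perturbation) has form domain `Q` (that of `q = q_0`, `PeriodicFormDomain.lean`) with
the graph norm `‖u‖²_Q + ‖rewardG s u‖²`, realised as the graph Hilbert space of
`Literature/Analysis/InnerProduct/CompactEmbeddingGraphNorm.lean`; its embedding
`ι_s = graphEmbedding ι (rewardG s)` into `L²((ℝ/ℤ)^{3N})` is compact (Rellich for `ι` = `formEmbed`),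
so the spectral data `d : TwoModeData ι_s` of the two lowest rewarded form eigenvalues exist
(`nonempty_twoModeData_reward`), and the dictionary of `PeriodicFormSpectrum.lean` goes through verbatim:

* `norm_sq_add_norm_rewardG_sq_trialState` — `‖graphEmbed Ψ‖² + ‖rewardG s (graphEmbed Ψ)‖² = 1 + rewardedEnergy s Ψ`;
* `le_rewardedEnergy_of_twoModeData` — every trial state has rewarded energy `≥ κ₁⁻¹ - 1`;
* `le_add_rewardedEnergy_of_twoModeData` — **Ky Fan**: every `L²`-orthogonal pair has total rewarded energy
  `≥ κ₁⁻¹ + κ₂⁻¹ - 2`;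
* `rewardedGroundStateEnergy_eq_ofReal` — **the rewarded variational ground-state energy is the lowest
  rewarded form eigenvalue**, `R(s) = κ₁⁻¹ - 1` (upper half over the dense core, `dense_coreRange`);
* `two_mul_rewardedGroundStateEnergy_add_le` — `2R(s) + (κ₂⁻¹ - κ₁⁻¹) ≤ rewardedEnergy s Φ₁ + rewardedEnergy s Φ₂`
  for `L²`-orthogonal pairs (so a STRICT Ky-Fan gap follows from `κ₂ < κ₁`, `PeriodicRewardedMaxFormSimplicity.lean`).

## References
* [ReedSimonIV1978] Reed–Simon IV, Thm. XIII.1–XIII.2 (min–max), XIII.64 (compact resolvent), XIII.68.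
* [Kato1966] T. Kato, *Perturbation Theory for Linear Operators*, Ch. VI §1.6, Thm. VI.1.33.
-/

noncomputable section

open MeasureTheory Filter Set Complex UnitAddTorus
open scoped ENNReal NNReal Topology InnerProductSpace ComplexConjugate
open Literature.Analysis.FunctionSpaces Literature.Analysis.OperatorTheory Literature.Analysis.InnerProduct

namespace Summit.AtomisticToContinuum.BoseEinsteinCondensation.Cruxes.RewardChordBound.Birth.RewardedFormSpectrum

open Literature.MathematicalPhysics.QuantumManyBody.BoseGas

-- The measure on `ℝ/ℤ` is the Haar PROBABILITY measure, as in `PeriodicFormDomain.lean`.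
attribute [local instance] Literature.MathematicalPhysics.QuantumManyBody.BoseGas.formDomain_measureSpace
  Literature.MathematicalPhysics.QuantumManyBody.BoseGas.formDomain_isProbabilityMeasure
  Literature.MathematicalPhysics.QuantumManyBody.BoseGas.formDomain_isProbabilityMeasure_pi

variable {N : ℕ} {L : ℝ} {v : ℝ → ℝ≥0∞} {s : ℝ}

/-- Local notation for the Hilbert space `L²((ℝ/ℤ)^{3N})`, as in `PeriodicFormDomain.lean`. -/
local notation "L2T " N':max => Lp ℂ 2 (volume : Measure (UnitAddTorus (Fin N' × Fin 3)))

section Spectrum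

variable (hL : 0 < L) (hv : Measurable v) (hW : ∫⁻ X in cellN N L, periodicInteraction v L X ≠ ⊤)

/-- The rewarded energy of a trial state is finite (`W ∈ L¹` of the cell). [folklore] -/
theorem rewardedEnergy_ne_top (s : ℝ) (Ψ : PeriodicTrialState N L) : rewardedEnergy hL hv hW s Ψ ≠ ⊤ := by
  have hfin : periodicEnergy v Ψ ≠ ⊤ := (lintegral_energy_lt_top hv hW Ψ.contDiff).ne
  rw [rewardedEnergy_def]
  exact ENNReal.add_ne_top.2 ⟨hfin, ENNReal.ofReal_ne_top⟩

/-- `(rewardedEnergy s Ψ).toReal = (periodicEnergy v Ψ).toReal + s · dep(ιΨ)` for `s ≥ 0`. [folklore] -/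
theorem toReal_rewardedEnergy (hs : 0 ≤ s) (Ψ : PeriodicTrialState N L) :
    (rewardedEnergy hL hv hW s Ψ).toReal = (periodicEnergy v Ψ).toReal + s * depletion N (formEmbed hL hv hW
      ⟨graphEmbed hL hv hW ⟨Ψ.ψ, Ψ.mem_periodicCore⟩, graphEmbed_mem_formDomain hL hv hW _⟩) := by
  have hfin : periodicEnergy v Ψ ≠ ⊤ := (lintegral_energy_lt_top hv hW Ψ.contDiff).ne
  rw [rewardedEnergy_def, ENNReal.toReal_add hfin ENNReal.ofReal_ne_top,
    ENNReal.toReal_ofReal (mul_nonneg hs (depletion_nonneg _))]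

/-- **The graph norm of a trial state is `1 +` its rewarded energy**:
`‖graphEmbed Ψ‖² + ‖rewardG s (graphEmbed Ψ)‖² = 1 + rewardedEnergy s Ψ` (`s ≥ 0`). [cite: Kato1966, Ch. VI §1.6] -/
theorem norm_sq_add_norm_rewardG_sq_trialState (hs : 0 ≤ s) (Ψ : PeriodicTrialState N L) :
    ‖(⟨graphEmbed hL hv hW ⟨Ψ.ψ, Ψ.mem_periodicCore⟩, graphEmbed_mem_formDomain hL hv hW _⟩ : formDomain hL hv hW)‖ ^ 2 +
      ‖rewardG hL hv hW s ⟨graphEmbed hL hv hW ⟨Ψ.ψ, Ψ.mem_periodicCore⟩, graphEmbed_mem_formDomain hL hv hW _⟩‖ ^ 2 =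
      1 + (rewardedEnergy hL hv hW s Ψ).toReal := by
  rw [norm_rewardG_sq hL hv hW hs, toReal_rewardedEnergy hL hv hW hs, ← add_assoc]
  congr 1
  exact norm_graphEmbed_sq_trialState hL hv hW Ψ

/-- **The spectral data of the two lowest rewarded eigenvalues exist** (`N ≥ 1`, `L > 0`, `W ∈ L¹` of the
cell, any `s`): the rewarded embedding is compact (Rellich, `isCompactOperator_formEmbed`, and
`isCompactOperator_graphEmbedding`) and the constant and a symmetrised plane wave have orthogonal non-zero
images. [cite: ReedSimonIV1978, Thm. XIII.64 and Thm. XIII.68] -/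
theorem nonempty_twoModeData_reward (hN : 0 < N) (s : ℝ) :
    Nonempty (TwoModeData (graphEmbedding (formEmbed hL hv hW) (rewardG hL hv hW s))) :=
  nonempty_twoModeData_graph (formEmbed hL hv hW) (rewardG hL hv hW s) (isCompactOperator_formEmbed hL hv hW)
    (exists_orthogonal_formEmbed hL hv hW hN)

/-- `‖ι_s e₁‖ ≤ ‖e₁‖` for the rewarded embedding (`‖ιψ‖ ≤ ‖ψ‖_Q ≤ ‖(ψ, rewardG s ψ)‖`). [folklore] -/
theorem norm_rewardEmbed_e₁_le {hL : 0 < L} {hv : Measurable v}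
    {hW : ∫⁻ X in cellN N L, periodicInteraction v L X ≠ ⊤}
    (d : TwoModeData (graphEmbedding (formEmbed hL hv hW) (rewardG hL hv hW s))) :
    ‖graphEmbedding (formEmbed hL hv hW) (rewardG hL hv hW s) d.e₁‖ ≤ ‖d.e₁‖ := by
  rw [graphEmbedding_apply]
  refine (norm_formEmbed_le hL hv hW _).trans ?_
  have h := norm_sq_eq_of_mem_graphSpace (rewardG hL hv hW s) d.e₁
  refine (pow_le_pow_iff_left₀ (norm_nonneg _) (norm_nonneg _) two_ne_zero).1 ?_
  rw [h]
  exact le_add_of_nonneg_right (sq_nonneg _)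

/-- `‖ι_s e₁‖ ≤ 1`. [folklore] -/
theorem norm_rewardEmbed_e₁_le_one {hL : 0 < L} {hv : Measurable v}
    {hW : ∫⁻ X in cellN N L, periodicInteraction v L X ≠ ⊤}
    (d : TwoModeData (graphEmbedding (formEmbed hL hv hW) (rewardG hL hv hW s))) :
    ‖graphEmbedding (formEmbed hL hv hW) (rewardG hL hv hW s) d.e₁‖ ≤ 1 :=
  (norm_rewardEmbed_e₁_le d).trans_eq d.norm_e₁

/-- `κ₁ ≤ 1` for the rewarded data (the lowest rewarded eigenvalue `κ₁⁻¹ - 1` is non-negative). [folklore] -/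
theorem twoModeData_reward_κ₁_le_one {hL : 0 < L} {hv : Measurable v}
    {hW : ∫⁻ X in cellN N L, periodicInteraction v L X ≠ ⊤}
    (d : TwoModeData (graphEmbedding (formEmbed hL hv hW) (rewardG hL hv hW s))) : d.κ₁ ≤ 1 := by
  have h1 := d.norm_map_e₁_sq
  have h2 := norm_rewardEmbed_e₁_le_one d
  have h3 := pow_le_pow_left₀ (norm_nonneg _) h2 2
  rw [h1, one_pow] at h3
  exact h3

/-- `1 ≤ κ₁⁻¹` for the rewarded data. [folklore] -/
theorem twoModeData_reward_one_le_inv_κ₁ {hL : 0 < L} {hv : Measurable v}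
    {hW : ∫⁻ X in cellN N L, periodicInteraction v L X ≠ ⊤}
    (d : TwoModeData (graphEmbedding (formEmbed hL hv hW) (rewardG hL hv hW s))) : 1 ≤ d.κ₁⁻¹ :=
  (one_le_inv₀ d.κ₁_pos).2 (twoModeData_reward_κ₁_le_one d)

/-- `1 ≤ κ₂⁻¹` for the rewarded data. [folklore] -/
theorem twoModeData_reward_one_le_inv_κ₂ {hL : 0 < L} {hv : Measurable v}
    {hW : ∫⁻ X in cellN N L, periodicInteraction v L X ≠ ⊤}
    (d : TwoModeData (graphEmbedding (formEmbed hL hv hW) (rewardG hL hv hW s))) : 1 ≤ d.κ₂⁻¹ :=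
  (one_le_inv₀ d.κ₂_pos).2 (d.κ₂_le_κ₁.trans (twoModeData_reward_κ₁_le_one d))

/-- The rewarded energy of the trial state of a normalised core function:
`rewardedEnergy s = ‖graphEmbed Φ‖² + ‖rewardG s (graphEmbed Φ)‖² - 1`. [folklore] -/
theorem rewardedEnergy_ofCore (hs : 0 ≤ s) (Φ : periodicCore N L)
    (h1 : ‖formEmbed hL hv hW ⟨graphEmbed hL hv hW Φ, graphEmbed_mem_formDomain hL hv hW Φ⟩‖ = 1) :
    rewardedEnergy hL hv hW s (PeriodicTrialState.ofCore hL hv hW Φ h1) =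
      ENNReal.ofReal (‖(⟨graphEmbed hL hv hW Φ, graphEmbed_mem_formDomain hL hv hW Φ⟩ : formDomain hL hv hW)‖ ^ 2 +
        ‖rewardG hL hv hW s ⟨graphEmbed hL hv hW Φ, graphEmbed_mem_formDomain hL hv hW Φ⟩‖ ^ 2 - 1) := by
  have h := norm_sq_add_norm_rewardG_sq_trialState hL hv hW hs (PeriodicTrialState.ofCore hL hv hW Φ h1)
  have hΦ : (⟨(PeriodicTrialState.ofCore hL hv hW Φ h1).ψ,
      (PeriodicTrialState.ofCore hL hv hW Φ h1).mem_periodicCore⟩ : periodicCore N L) = Φ := rfl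
  rw [hΦ] at h
  rw [h, add_sub_cancel_left, ENNReal.ofReal_toReal (rewardedEnergy_ne_top hL hv hW s _)]

/-- **Every trial state has rewarded energy at least `κ₁⁻¹ - 1`.** [cite: ReedSimonIV1978, Thm. XIII.1] -/
theorem le_rewardedEnergy_of_twoModeData {hL : 0 < L} {hv : Measurable v}
    {hW : ∫⁻ X in cellN N L, periodicInteraction v L X ≠ ⊤} (hs : 0 ≤ s)
    (d : TwoModeData (graphEmbedding (formEmbed hL hv hW) (rewardG hL hv hW s))) (Ψ : PeriodicTrialState N L) :
    ENNReal.ofReal (d.κ₁⁻¹ - 1) ≤ rewardedEnergy hL hv hW s Ψ := by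
  have h2 := (d.le_norm_sq_add_of_graph (norm_formEmbed_graphEmbed_trialState hL hv hW Ψ)).trans_eq
    (norm_sq_add_norm_rewardG_sq_trialState hL hv hW hs Ψ)
  calc ENNReal.ofReal (d.κ₁⁻¹ - 1) ≤ ENNReal.ofReal (rewardedEnergy hL hv hW s Ψ).toReal :=
        ENNReal.ofReal_le_ofReal (sub_le_iff_le_add'.2 h2)
    _ ≤ rewardedEnergy hL hv hW s Ψ := ENNReal.ofReal_toReal_le

/-- **Ky Fan for the rewarded form**: every `L²`-orthogonal pair of trial states has total rewarded energy
at least `κ₁⁻¹ + κ₂⁻¹ - 2`. [cite: ReedSimonIV1978, Thm. XIII.1–2] -/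
theorem le_add_rewardedEnergy_of_twoModeData {hL : 0 < L} {hv : Measurable v}
    {hW : ∫⁻ X in cellN N L, periodicInteraction v L X ≠ ⊤} (hs : 0 ≤ s)
    (d : TwoModeData (graphEmbedding (formEmbed hL hv hW) (rewardG hL hv hW s)))
    (Ψ₁ Ψ₂ : PeriodicTrialState N L) (horth : ∫ X in cellN N L, conj (Ψ₁.ψ X) * Ψ₂.ψ X = 0) :
    ENNReal.ofReal (d.κ₁⁻¹ + d.κ₂⁻¹ - 2) ≤ rewardedEnergy hL hv hW s Ψ₁ + rewardedEnergy hL hv hW s Ψ₂ := by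
  have h12 : ⟪formEmbed hL hv hW ⟨graphEmbed hL hv hW ⟨Ψ₁.ψ, Ψ₁.mem_periodicCore⟩,
      graphEmbed_mem_formDomain hL hv hW _⟩, formEmbed hL hv hW ⟨graphEmbed hL hv hW
      ⟨Ψ₂.ψ, Ψ₂.mem_periodicCore⟩, graphEmbed_mem_formDomain hL hv hW _⟩⟫_ℂ = 0 := by
    rw [inner_formEmbed_graphEmbed]; exact horth
  have h := d.kyFan_two_le_of_graph (norm_formEmbed_graphEmbed_trialState hL hv hW Ψ₁)
    (norm_formEmbed_graphEmbed_trialState hL hv hW Ψ₂) h12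
  have h' : d.κ₁⁻¹ + d.κ₂⁻¹ ≤ (1 + (rewardedEnergy hL hv hW s Ψ₁).toReal) + (1 + (rewardedEnergy hL hv hW s Ψ₂).toReal) :=
    h.trans_eq (by rw [norm_sq_add_norm_rewardG_sq_trialState hL hv hW hs, norm_sq_add_norm_rewardG_sq_trialState hL hv hW hs])
  have h'' : d.κ₁⁻¹ + d.κ₂⁻¹ - 2 ≤ (rewardedEnergy hL hv hW s Ψ₁).toReal + (rewardedEnergy hL hv hW s Ψ₂).toReal := by
    have h3 := h'.trans_eq (add_add_add_comm _ _ _ _)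
    rw [one_add_one_eq_two] at h3
    exact sub_le_iff_le_add'.2 h3
  calc ENNReal.ofReal (d.κ₁⁻¹ + d.κ₂⁻¹ - 2)
      ≤ ENNReal.ofReal ((rewardedEnergy hL hv hW s Ψ₁).toReal + (rewardedEnergy hL hv hW s Ψ₂).toReal) :=
        ENNReal.ofReal_le_ofReal h''
    _ = ENNReal.ofReal (rewardedEnergy hL hv hW s Ψ₁).toReal + ENNReal.ofReal (rewardedEnergy hL hv hW s Ψ₂).toReal :=
        ENNReal.ofReal_add ENNReal.toReal_nonneg ENNReal.toReal_nonneg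
    _ ≤ rewardedEnergy hL hv hW s Ψ₁ + rewardedEnergy hL hv hW s Ψ₂ :=
        add_le_add ENNReal.ofReal_toReal_le ENNReal.ofReal_toReal_le

/-- **The rewarded variational ground-state energy is the lowest rewarded form eigenvalue**:
`rewardedGroundStateEnergy s = κ₁⁻¹ - 1` for any rewarded `TwoModeData` (upper half over the dense core
`coreRange`, `TwoModeData.exists_lt_of_dense_of_graph`). [cite: ReedSimonIV1978, Thm. XIII.1] -/
theorem rewardedGroundStateEnergy_eq_ofReal {hL : 0 < L} {hv : Measurable v}
    {hW : ∫⁻ X in cellN N L, periodicInteraction v L X ≠ ⊤} (hs : 0 ≤ s)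
    (d : TwoModeData (graphEmbedding (formEmbed hL hv hW) (rewardG hL hv hW s))) :
    rewardedGroundStateEnergy hL hv hW s = ENNReal.ofReal (d.κ₁⁻¹ - 1) := by
  refine le_antisymm ?_ (le_rewardedGroundStateEnergy hL hv hW fun Ψ => le_rewardedEnergy_of_twoModeData hs d Ψ)
  refine ENNReal.le_of_forall_pos_le_add fun ε hε _ => ?_
  have h1 := twoModeData_reward_one_le_inv_κ₁ d
  obtain ⟨ψ, hψS, hψ1, hlt⟩ := d.exists_lt_of_dense_of_graph (dense_coreRange hL hv hW) (ε := ε) (by exact_mod_cast hε)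
  obtain ⟨Φ, rfl⟩ := exists_eq_graphEmbed_of_mem_coreRange hψS
  calc rewardedGroundStateEnergy hL hv hW s ≤ rewardedEnergy hL hv hW s (PeriodicTrialState.ofCore hL hv hW Φ hψ1) :=
        rewardedGroundStateEnergy_le hL hv hW s _
    _ = ENNReal.ofReal (‖(⟨graphEmbed hL hv hW Φ, graphEmbed_mem_formDomain hL hv hW Φ⟩ : formDomain hL hv hW)‖ ^ 2 +
          ‖rewardG hL hv hW s ⟨graphEmbed hL hv hW Φ, graphEmbed_mem_formDomain hL hv hW Φ⟩‖ ^ 2 - 1) :=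
        rewardedEnergy_ofCore hL hv hW hs Φ hψ1
    _ ≤ ENNReal.ofReal (d.κ₁⁻¹ + ε - 1) := ENNReal.ofReal_le_ofReal (sub_le_sub_right hlt.le 1)
    _ = ENNReal.ofReal (d.κ₁⁻¹ - 1) + ε := by
        rw [show d.κ₁⁻¹ + (ε : ℝ) - 1 = d.κ₁⁻¹ - 1 + ε by ring,
          ENNReal.ofReal_add (sub_nonneg.2 h1) ε.coe_nonneg, ENNReal.ofReal_coe_nnreal]

/-- The rewarded ground-state energy is finite (`N ≥ 1`, `W ∈ L¹` of the cell, `s ≥ 0`). [folklore] -/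
theorem rewardedGroundStateEnergy_ne_top (hN : 0 < N) (hs : 0 ≤ s) : rewardedGroundStateEnergy hL hv hW s ≠ ⊤ := by
  obtain ⟨d⟩ := nonempty_twoModeData_reward hL hv hW hN s
  rw [rewardedGroundStateEnergy_eq_ofReal hs d]
  exact ENNReal.ofReal_ne_top

/-- Real arithmetic in `ℝ≥0∞`: `2·(a - 1) + (b - a) = a + b - 2` for `1 ≤ a ≤ b`. [folklore] -/
theorem two_mul_ofReal_sub_one_add_ofReal_sub {a b : ℝ} (h1 : 1 ≤ a) (hab : a ≤ b) :
    2 * ENNReal.ofReal (a - 1) + ENNReal.ofReal (b - a) = ENNReal.ofReal (a + b - 2) := by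
  have h3 : (2 : ℝ≥0∞) * ENNReal.ofReal (a - 1) = ENNReal.ofReal (2 * (a - 1)) := by
    rw [ENNReal.ofReal_mul zero_le_two, ENNReal.ofReal_ofNat]
  rw [h3, ← ENNReal.ofReal_add (by linarith) (by linarith)]
  congr 1
  ring

/-- **Ky Fan for the rewarded form, energy form**: for every rewarded `TwoModeData` and every
`L²`-orthogonal pair of trial states, `2 R(s) + (κ₂⁻¹ - κ₁⁻¹) ≤ rewardedEnergy s Φ₁ + rewardedEnergy s Φ₂`.
[cite: ReedSimonIV1978, Thm. XIII.1–2] -/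
theorem two_mul_rewardedGroundStateEnergy_add_le {hL : 0 < L} {hv : Measurable v}
    {hW : ∫⁻ X in cellN N L, periodicInteraction v L X ≠ ⊤} (hs : 0 ≤ s)
    (d : TwoModeData (graphEmbedding (formEmbed hL hv hW) (rewardG hL hv hW s)))
    (Ψ₁ Ψ₂ : PeriodicTrialState N L) (horth : ∫ X in cellN N L, conj (Ψ₁.ψ X) * Ψ₂.ψ X = 0) :
    2 * rewardedGroundStateEnergy hL hv hW s + ENNReal.ofReal (d.κ₂⁻¹ - d.κ₁⁻¹) ≤
      rewardedEnergy hL hv hW s Ψ₁ + rewardedEnergy hL hv hW s Ψ₂ := by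
  have h1 : 1 ≤ d.κ₁⁻¹ := twoModeData_reward_one_le_inv_κ₁ d
  have hinv : d.κ₁⁻¹ ≤ d.κ₂⁻¹ := (inv_le_inv₀ d.κ₁_pos d.κ₂_pos).2 d.κ₂_le_κ₁
  rw [rewardedGroundStateEnergy_eq_ofReal hs d, two_mul_ofReal_sub_one_add_ofReal_sub h1 hinv]
  exact le_add_rewardedEnergy_of_twoModeData hs d Ψ₁ Ψ₂ horth

end Spectrum

end Summit.AtomisticToContinuum.BoseEinsteinCondensation.Cruxes.RewardChordBound.Birth.RewardedFormSpectrum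

namespace Summit.AtomisticToContinuum.BoseEinsteinCondensation.Cruxes.RewardChordBound.Birth

open Summit.AtomisticToContinuum.BoseEinsteinCondensation.Cruxes.RewardChordBound.Birth.RewardedFormSpectrum
  Literature.MathematicalPhysics.QuantumManyBody.BoseGas

/-- **Registered sub-goal of stub `stub_rewardedKyFanGapIntegrable` (helper file F4): the two lowest rewarded
form eigenvalues.** For `L > 0`, `W ∈ L¹` of the cell, `s ≥ 0`, `N ≥ 1` there are `0 < κ₂ ≤ κ₁` with
`R(s) = κ₁⁻¹ - 1` and the Ky-Fan bound `2R(s) + (κ₂⁻¹ - κ₁⁻¹) ≤ rewardedEnergy s Φ₁ + rewardedEnergy s Φ₂` for all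
`L²`-orthogonal pairs of trial states (so the strict gap is `κ₂ < κ₁`, F7). [cite: ReedSimonIV1978, Thm. XIII.1–2 and XIII.64] -/
theorem stub_rewardedKyFanGapIntegrable_RewardedFormSpectrum :
    ∀ (N : ℕ) (L : ℝ) (v : ℝ → ENNReal) (hL : 0 < L) (hv : Measurable v) (hW : (∫⁻ X in Literature.MathematicalPhysics.QuantumManyBody.BoseGas.cellN N L, Literature.MathematicalPhysics.QuantumManyBody.BoseGas.periodicInteraction v L X) ≠ ⊤) (s : ℝ), 0 ≤ s → 0 < N → ∃ κ₁ κ₂ : ℝ, 0 < κ₂ ∧ κ₂ ≤ κ₁ ∧ Literature.MathematicalPhysics.QuantumManyBody.BoseGas.rewardedGroundStateEnergy hL hv hW s = ENNReal.ofReal (κ₁⁻¹ - 1) ∧ ∀ Φ₁ Φ₂ : Literature.MathematicalPhysics.QuantumManyBody.BoseGas.PeriodicTrialState N L, (∫ X in Literature.MathematicalPhysics.QuantumManyBody.BoseGas.cellN N L, starRingEnd ℂ (Φ₁.ψ X) * Φ₂.ψ X) = 0 → 2 * Literature.MathematicalPhysics.QuantumManyBody.BoseGas.rewardedGroundStateEnergy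 hL hv hW s + ENNReal.ofReal (κ₂⁻¹ - κ₁⁻¹) ≤ Literature.MathematicalPhysics.QuantumManyBody.BoseGas.rewardedEnergy hL hv hW s Φ₁ + Literature.MathematicalPhysics.QuantumManyBody.BoseGas.rewardedEnergy hL hv hW s Φ₂ := by
  intro N L v hL hv hW s hs hN
  obtain ⟨d⟩ := nonempty_twoModeData_reward hL hv hW hN s
  exact ⟨d.κ₁, d.κ₂, d.κ₂_pos, d.κ₂_le_κ₁, rewardedGroundStateEnergy_eq_ofReal hs d,
    fun Φ₁ Φ₂ horth => two_mul_rewardedGroundStateEnergy_add_le hs d Φ₁ Φ₂ horth⟩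

end Summit.AtomisticToContinuum.BoseEinsteinCondensation.Cruxes.RewardChordBound.Birth

end
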